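import Mathlib
import Literature.MathematicalPhysics.QuantumLattice.HeisenbergOrderNeelRiemann3
import HarnessLib

/-!
# Taylor bounds of degree 5 and 7 for `sin` on `[0, ∞)`

Stub `stub_sinTaylor` for the line *parity–multiplicity–commutator* of the crux
`GroundStateSimpleEven` (Weil ground state): the alternating Taylor polynomials of `sin`
bracket it on `[0, ∞)`,
`x − x³/6 + x⁵/120 − x⁷/5040 ≤ sin x ≤ x − x³/6 + x⁵/120` for `x ≥ 0`.
Mathlib stops at degree 3 (`Real.sin_ge_sub_cube : x − x³/6 ≤ sin x`); the integration ladder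
from there (`cos x ≤ 1 − x²/2 + x⁴/24`, `sin x ≤ x − x³/6 + x⁵/120`,
`1 − x²/2 + x⁴/24 − x⁶/720 ≤ cos x`, `x − x³/6 + x⁵/120 − x⁷/5040 ≤ sin x`, one monotonicity
step per rung) is already in the tree as
`Literature.MathematicalPhysics.QuantumLattice.KLSNumerics.sin_le_taylor_five` /
`taylor_seven_le_sin` (certified numerics of Kennedy–Lieb–Shastry); we re-export the two bounds
in the shape registered by the skeleton.
-/

open Set MeasureTheory Filter

open scoped Real Topology

namespace Summit.RiemannHypothesis.RiemannHypothesis.Theorems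

set_option linter.dupNamespace false in
/-- **Taylor bracket for `sin` on `[0, ∞)`**: for `x ≥ 0`,
`x − x³/6 + x⁵/120 − x⁷/5040 ≤ sin x ≤ x − x³/6 + x⁵/120` (alternating-series bounds, obtained
by integrating `x − x³/6 ≤ sin x` four times; tree lemmas
`KLSNumerics.sin_le_taylor_five` and `KLSNumerics.taylor_seven_le_sin`). [folklore] -/
theorem stub_sinTaylor :
    ∀ x : ℝ, 0 ≤ x →
      Real.sin x ≤ x - x ^ 3 / 6 + x ^ 5 / 120 ∧
        x - x ^ 3 / 6 + x ^ 5 / 120 - x ^ 7 / 5040 ≤ Real.sin x :=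
  fun _ hx ↦
    ⟨Literature.MathematicalPhysics.QuantumLattice.KLSNumerics.sin_le_taylor_five hx,
      Literature.MathematicalPhysics.QuantumLattice.KLSNumerics.taylor_seven_le_sin hx⟩

end Summit.RiemannHypothesis.RiemannHypothesis.Theorems
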